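import Literature.NumberTheory.Transcendental.KZLogCalculusProofs
import Literature.NumberTheory.Transcendental.KZCalculusProofs
import Literature.NumberTheory.Transcendental.KZProductIdeal
import Literature.NumberTheory.Transcendental.KZFibredRelations
import Literature.NumberTheory.Transcendental.KZRulesAssociator
import Literature.NumberTheory.Transcendental.SemialgebraicMapsProofs
import Literature.NumberTheory.Transcendental.PeriodConjecture
import Summits.KontsevichZagierPeriods.KontsevichZagierPeriods.Theorems.LogKernelConjecture.Negative.Sandwich

/-!
# The ENGINE of line `spectator-localisation` (crux stmt-KontsevichZagierPeriods-2837, skeleton d39c9ad6)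
is a THEOREM: all four engine stubs proved, `FibredSpectatorCancellation₁` unconditional, and the
exact split `Kernel ↔ stub_darkTorsion ∧ stub_spectatorFibration`

Refuter drefute seat `refuter-drefute-stmt-KontsevichZagierPeriods-2837-g2-0` (gen 2), 2026-08-16.
Self-contained union of `GoodWeight.lean` (stub_goodWeight), `Reweighting.lean` (stub_reweighting),
`EngineAssembly.lean` (stub_engineAssembly) and the gen-1 proof of `stub_intervalUnit`, followed by
`fibredSpectatorCancellation₁ : FSC₁`, `spectatorFibration₁_iff_cancellation` and
`kernel_iff_darkTorsion₁_and_spectatorFibration₁`.  Candidate proofs for the lead prover; negative-side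
reading: after this file the line's ONLY open content is `SC₁ ∧ DarkTorsion₁`, jointly EQUAL to the
kernel conjecture.
-/

noncomputable section

namespace DrefuteSpectatorLocalisationG2

/-! ## stub_goodWeight -/


open MeasureTheory Set Filter MvPolynomial Metric
open scoped Topology
open Literature.NumberTheory.Transcendental Literature.ModelTheory.ExponentialFields

/-- A vector in `ℝ¹` is the constant function with value its `0`-th coordinate. -/
theorem eq_const_of_fin_one (t : Fin 1 → ℝ) : t = fun _ => t 0 := by
  funext i
  rw [Subsingleton.elim i 0]

theorem init_eq_const (v : Fin 2 → ℝ) : (Fin.init v : Fin 1 → ℝ) = fun _ => v 0 := by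
  funext i
  rw [Subsingleton.elim i 0]
  rfl

/-- The open rational coordinate interval `{a < t 0 < b} ⊆ ℝ¹` is `ℚ`-semialgebraic. -/
theorem isSemialgebraic_iooSet (a b : ℚ) :
    IsSemialgebraic ℚ {t : Fin 1 → ℝ | (a : ℝ) < t 0 ∧ t 0 < (b : ℝ)} := by
  have h1 := isSemialgebraic_setOf_eval_lt (k := ℚ) (R := ℝ) (C a) (X (0 : Fin 1))
  have h2 := isSemialgebraic_setOf_eval_lt (k := ℚ) (R := ℝ) (X (0 : Fin 1)) (C b)
  simp only [aeval_X, aeval_C, eq_ratCast] at h1 h2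
  simpa [setOf_and] using h1.inter h2

/-- The closed rational coordinate interval `{a ≤ t 0 ≤ b} ⊆ ℝ¹` is `ℚ`-semialgebraic. -/
theorem isSemialgebraic_iccSet (a b : ℚ) :
    IsSemialgebraic ℚ {t : Fin 1 → ℝ | (a : ℝ) ≤ t 0 ∧ t 0 ≤ (b : ℝ)} := by
  have h1 := isSemialgebraic_setOf_eval_le (k := ℚ) (R := ℝ) (C a) (X (0 : Fin 1))
  have h2 := isSemialgebraic_setOf_eval_le (k := ℚ) (R := ℝ) (X (0 : Fin 1)) (C b)
  simp only [aeval_X, aeval_C, eq_ratCast] at h1 h2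
  simpa [setOf_and] using h1.inter h2

theorem isOpen_iooSet (a b : ℝ) : IsOpen {t : Fin 1 → ℝ | a < t 0 ∧ t 0 < b} := by
  have : {t : Fin 1 → ℝ | a < t 0 ∧ t 0 < b} = (fun t : Fin 1 → ℝ => t 0) ⁻¹' Ioo a b := by
    ext t; simp
  rw [this]
  exact isOpen_Ioo.preimage (continuous_apply 0)

/-- `{x ∈ D | f x ≠ 0}` is `ℚ`-semialgebraic for a `ℚ`-semialgebraic function `f` on `D`. -/
theorem isSemialgebraic_sep_ne_zero {m : ℕ} {D : Set (Fin m → ℝ)} {f : (Fin m → ℝ) → ℝ}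
    (hf : IsSemialgebraicFunOn ℚ D f) : IsSemialgebraic ℚ {x | x ∈ D ∧ f x ≠ 0} := by
  have hT : IsSemialgebraic ℚ {u : Fin (m + 1) → ℝ | aeval u (X (Fin.last m) : MvPolynomial _ ℚ) ≠ 0} :=
    isSemialgebraic_setOf_eval_ne_zero _
  convert hf.isSemialgebraic_sep_snoc_mem tarski_seidenberg_real_holds hT using 1
  ext x
  simp

/-- **Core of `stub_goodWeight`.** A one-dimensional representation of non-zero value has a closed
rational interval inside its domain on which the integrand is bounded away from `0`. -/
theorem exists_good_interval (s : KZ.IntegralRep 1) (hs : s.value ≠ 0) :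
    ∃ (a b : ℚ) (m : ℝ), a < b ∧ 0 < m ∧
      ∀ t : Fin 1 → ℝ, (a : ℝ) ≤ t 0 → t 0 ≤ (b : ℝ) → t ∈ s.domain ∧ m ≤ |s.integrand t| := by
  set D := s.domain with hD
  set f := s.integrand with hf
  have hDsa : IsSemialgebraic ℚ D := s.isSemialgebraic_domain
  have hfsa : IsSemialgebraicFunOn ℚ D f := s.isSemialgebraicFunOn_integrand
  have hDm : MeasurableSet D := IsSemialgebraic.measurableSet_holds hDsa
  set S := {x | x ∈ D ∧ f x ≠ 0} with hS
  have hSsa : IsSemialgebraic ℚ S := isSemialgebraic_sep_ne_zero hfsa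
  -- `interior S` is non-empty, otherwise the value vanishes
  have hint : (interior S).Nonempty := by
    by_contra hne
    rw [not_nonempty_iff_eq_empty] at hne
    have hvol : volume S = 0 := KZ.volume_eq_zero_of_interior_eq_empty hSsa hne
    have hae : ∀ᵐ x ∂(volume.restrict D), f x = 0 := by
      rw [ae_restrict_iff' hDm, ae_iff]
      convert hvol using 2
      ext x
      simp [hS, Classical.not_imp]
    exact hs (integral_eq_zero_of_ae hae)
  obtain ⟨p, hp⟩ := hint
  obtain ⟨ε, hε, hball⟩ := Metric.mem_nhds_iff.mp (isOpen_interior.mem_nhds hp)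
  have hballS : ball p ε ⊆ S := hball.trans interior_subset
  -- an open rational interval `G` with `p ∈ G ⊆ S`
  obtain ⟨a₀, ha₀l, ha₀r⟩ := exists_rat_btwn (show p 0 - ε < p 0 by linarith)
  obtain ⟨b₀, hb₀l, hb₀r⟩ := exists_rat_btwn (show p 0 < p 0 + ε by linarith)
  set G := {t : Fin 1 → ℝ | (a₀ : ℝ) < t 0 ∧ t 0 < (b₀ : ℝ)} with hG
  have hGball : G ⊆ ball p ε := by
    intro t ht
    rw [mem_ball, dist_pi_lt_iff hε]
    intro i
    rw [Subsingleton.elim i 0, Real.dist_eq, abs_lt]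
    constructor <;> linarith [ht.1, ht.2]
  have hGS : G ⊆ S := hGball.trans hballS
  have hGD : G ⊆ D := fun t ht => (hGS ht).1
  have hGsa : IsSemialgebraic ℚ G := isSemialgebraic_iooSet a₀ b₀
  have hGopen : IsOpen G := isOpen_iooSet _ _
  have hpG : p ∈ G := ⟨ha₀r, hb₀l⟩
  have hfG : IsSemialgebraicFunOn ℚ G f := hfsa.mono hGD hGsa
  obtain ⟨Z, -, -, hZint, hopen, hsmooth⟩ :=
    IsSemialgebraicFunOn.exists_contDiffOn_holds (k := ℚ) hGopen hfG
  -- a point `q ∈ G \ Z`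
  have hGZ : (G \ Z).Nonempty := by
    by_contra hne
    rw [not_nonempty_iff_eq_empty] at hne
    have hsub : G ⊆ Z := fun x hx => by
      by_contra hxZ
      have : x ∈ G \ Z := ⟨hx, hxZ⟩
      rw [hne] at this
      exact this
    have : p ∈ interior Z := interior_mono hsub (by rwa [hGopen.interior_eq])
    rw [hZint] at this
    exact this
  obtain ⟨q, hq⟩ := hGZ
  have hqG : q ∈ G := hq.1
  have hfq : f q ≠ 0 := (hGS hqG).2
  have hcont : ContinuousAt f q :=
    (hsmooth.continuousOn.continuousAt (hopen.mem_nhds hq))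
  set m := |f q| / 2 with hm
  have hm0 : 0 < m := by positivity
  obtain ⟨δ, hδ, hδf⟩ := Metric.continuousAt_iff.mp hcont m hm0
  -- rationals `a < b` with `[a, b] ⊆ G ∩ ball q δ`
  have hlow : max (a₀ : ℝ) (q 0 - δ) < q 0 := max_lt hqG.1 (by linarith)
  have hhigh : q 0 < min (b₀ : ℝ) (q 0 + δ) := lt_min hqG.2 (by linarith)
  obtain ⟨a, hal, har⟩ := exists_rat_btwn hlow
  obtain ⟨b, hbl, hbr⟩ := exists_rat_btwn hhigh
  have hab : a < b := by
    have : (a : ℝ) < b := har.trans hbl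
    exact_mod_cast this
  refine ⟨a, b, m, hab, hm0, fun t hta htb => ?_⟩
  have ha₀a : (a₀ : ℝ) < a := lt_of_le_of_lt (le_max_left _ _) hal
  have hδa : q 0 - δ < a := lt_of_le_of_lt (le_max_right _ _) hal
  have hbb₀ : (b : ℝ) < b₀ := lt_of_lt_of_le hbr (min_le_left _ _)
  have hbδ : (b : ℝ) < q 0 + δ := lt_of_lt_of_le hbr (min_le_right _ _)
  have htG : t ∈ G := ⟨by linarith, by linarith⟩
  have htq : dist t q < δ := by
    rw [dist_pi_lt_iff hδ]
    intro i
    rw [Subsingleton.elim i 0, Real.dist_eq, abs_lt]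
    constructor <;> linarith
  have hft : dist (f t) (f q) < m := hδf htq
  refine ⟨hGD htG, ?_⟩
  rw [Real.dist_eq] at hft
  have h1 : |f q| ≤ |f t| + |f t - f q| := by
    calc |f q| = |f t - (f t - f q)| := by ring_nf
      _ ≤ |f t| + |f t - f q| := abs_sub _ _
  rw [hm] at hft ⊢
  linarith

/-! ### The weight -/

/-- **`stub_goodWeight` holds** (verbatim the registered signature of skeleton d39c9ad6). -/
theorem stub_goodWeight_holds :
    ∀ (s : Literature.NumberTheory.Transcendental.KZ.IntegralRep 1), s.value ≠ 0 → ∃ (a b : ℚ) (w : ℝ → ℝ) (M : ℝ), a < b ∧ Literature.NumberTheory.Transcendental.IsSemialgebraicFunOn ℚ (Set.univ : Set (Fin 1 → ℝ)) (fun t => w (t 0)) ∧ (∀ x : ℝ, |w x| ≤ M) ∧ (∀ t : Fin 1 → ℝ, (a : ℝ) ≤ t 0 → t 0 ≤ (b : ℝ) → t ∈ s.domain ∧ w (t 0) * s.integrand t = ((b - a : ℚ) : ℝ)⁻¹) ∧ (∀ x : ℝ, (x < (a : ℝ) ∨ (b : ℝ) < x) → w x = 0) := by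
  intro s hs
  obtain ⟨a, b, m, hab, hm0, hgood⟩ := exists_good_interval s hs
  classical
  set c : ℚ := (b - a)⁻¹ with hc
  have hcR : ((b - a : ℚ) : ℝ)⁻¹ = (c : ℝ) := by rw [hc]; push_cast; rfl
  -- the weight
  set w : ℝ → ℝ := fun x => if (a : ℝ) ≤ x ∧ x ≤ (b : ℝ) then (c : ℝ) / s.integrand (fun _ => x) else 0
    with hw
  have hw_in : ∀ x : ℝ, (a : ℝ) ≤ x → x ≤ (b : ℝ) → w x = (c : ℝ) / s.integrand (fun _ => x) := by
    intro x h1 h2; rw [hw]; exact if_pos ⟨h1, h2⟩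
  have hw_out : ∀ x : ℝ, (x < (a : ℝ) ∨ (b : ℝ) < x) → w x = 0 := by
    intro x hx; rw [hw]
    refine if_neg ?_
    rintro ⟨h1, h2⟩
    rcases hx with hx | hx <;> linarith
  -- non-vanishing of the integrand on `[a, b]`
  have hne : ∀ t : Fin 1 → ℝ, (a : ℝ) ≤ t 0 → t 0 ≤ (b : ℝ) → s.integrand t ≠ 0 := by
    intro t h1 h2 h0
    have := (hgood t h1 h2).2
    rw [h0, abs_zero] at this
    linarith
  refine ⟨a, b, w, |(c : ℝ)| / m, hab, ?_, ?_, ?_, hw_out⟩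
  · -- semialgebraicity of `t ↦ w (t 0)` on `ℝ¹`: graph = A ∪ B
    rw [isSemialgebraicFunOn_iff]
    set I := {t : Fin 1 → ℝ | (a : ℝ) ≤ t 0 ∧ t 0 ≤ (b : ℝ)} with hI
    have hIsa : IsSemialgebraic ℚ I := isSemialgebraic_iccSet a b
    have hID : I ⊆ s.domain := fun t ht => (hgood t ht.1 ht.2).1
    have hfI : IsSemialgebraicFunOn ℚ I s.integrand := s.isSemialgebraicFunOn_integrand.mono hID hIsa
    have hT : IsSemialgebraic ℚ
        {u : Fin (1 + 2) → ℝ | aeval u (X (1 : Fin 3) * X (2 : Fin 3) - C c : MvPolynomial (Fin 3) ℚ) = 0} :=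
      isSemialgebraic_setOf_eval_eq_zero _
    have hA := hfI.isSemialgebraic_setOf_snoc_mem tarski_seidenberg_real_holds hT
    have hB : IsSemialgebraic ℚ
        {v : Fin 2 → ℝ | (v 0 < (a : ℝ) ∨ (b : ℝ) < v 0) ∧ v 1 = 0} := by
      have h1 := isSemialgebraic_setOf_eval_lt (k := ℚ) (R := ℝ) (X (0 : Fin 2)) (C a)
      have h2 := isSemialgebraic_setOf_eval_lt (k := ℚ) (R := ℝ) (C b) (X (0 : Fin 2))
      have h3 := isSemialgebraic_setOf_eval_eq_zero (k := ℚ) (R := ℝ) (X (1 : Fin 2))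
      simp only [aeval_X, aeval_C, eq_ratCast] at h1 h2 h3
      simpa [setOf_and, setOf_or] using (h1.union h2).inter h3
    convert hA.union hB using 1
    ext v
    have e0 : (Fin.init v : Fin 1 → ℝ) 0 = v 0 := rfl
    have e1 : v (Fin.last 1) = v 1 := rfl
    have einit : (Fin.init v : Fin 1 → ℝ) = fun _ => v 0 := init_eq_const v
    simp only [mem_univ, true_and, mem_setOf_eq, mem_union, map_sub, map_mul, aeval_X, aeval_C,
      eq_ratCast, e1, hI, e0]
    have s1 : (Fin.snoc v (s.integrand (Fin.init v)) : Fin 3 → ℝ) 1 = v 1 := by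
      simp [Fin.snoc]
    have s2 : (Fin.snoc v (s.integrand (Fin.init v)) : Fin 3 → ℝ) 2 = s.integrand (Fin.init v) := by
      simp [Fin.snoc]
    rw [s1, s2, einit]
    by_cases hin : (a : ℝ) ≤ v 0 ∧ v 0 ≤ (b : ℝ)
    · have hF : s.integrand (fun _ => v 0) ≠ 0 := hne (fun _ => v 0) hin.1 hin.2
      rw [hw_in (v 0) hin.1 hin.2]
      constructor
      · intro h
        left
        exact ⟨hin, by rw [h, div_mul_cancel₀ _ hF, sub_self]⟩
      · rintro (⟨-, h⟩ | ⟨h, -⟩)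
        · rw [eq_div_iff hF]; linarith
        · exfalso; rcases h with h | h <;> linarith [hin.1, hin.2]
    · have hout : v 0 < (a : ℝ) ∨ (b : ℝ) < v 0 := by
        rcases not_and_or.mp hin with h | h
        · exact Or.inl (not_le.mp h)
        · exact Or.inr (not_le.mp h)
      rw [hw_out (v 0) hout]
      constructor
      · intro h; right; exact ⟨hout, h⟩
      · rintro (⟨h, -⟩ | ⟨-, h⟩)
        · exact absurd h hin
        · exact h
  · -- the bound
    intro x
    by_cases hin : (a : ℝ) ≤ x ∧ x ≤ (b : ℝ)
    · rw [hw_in x hin.1 hin.2, abs_div]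
      have hmt := (hgood (fun _ => x) hin.1 hin.2).2
      exact div_le_div_of_nonneg_left (abs_nonneg _) hm0 hmt
    · have hout : x < (a : ℝ) ∨ (b : ℝ) < x := by
        rcases not_and_or.mp hin with h | h
        · exact Or.inl (not_le.mp h)
        · exact Or.inr (not_le.mp h)
      rw [hw_out x hout, abs_zero]
      positivity
  · -- the identity on `[a, b]`
    intro t h1 h2
    refine ⟨(hgood t h1 h2).1, ?_⟩
    rw [hw_in (t 0) h1 h2, ← eq_const_of_fin_one t, hcR]
    exact div_mul_cancel₀ _ (hne t h1 h2)


/-! ## stub_reweighting -/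


open MeasureTheory Set Filter MvPolynomial
open scoped Topology
open Literature.NumberTheory.Transcendental Literature.ModelTheory.ExponentialFields

section Weight

variable {w : ℝ → ℝ} (hw : IsSemialgebraicFunOn ℚ (univ : Set (Fin 1 → ℝ)) (fun t => w (t 0)))
  {M : ℝ} (hM : ∀ x : ℝ, |w x| ≤ M)

include hw in
/-- `x ↦ w (x i)` is `ℚ`-semialgebraic on all of `ℝᵏ` (coordinate preimage of the graph of `w`). -/
theorem isSemialgebraicFunOn_coord {k : ℕ} (i : Fin k) :
    IsSemialgebraicFunOn ℚ (univ : Set (Fin k → ℝ)) (fun x => w (x i)) := by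
  rw [isSemialgebraicFunOn_iff] at hw ⊢
  convert hw.preimage_comp ![Fin.castSucc i, Fin.last k] using 1
  ext z
  simp only [mem_univ, true_and, mem_setOf_eq, mem_preimage]
  have h1 : (z ∘ ![Fin.castSucc i, Fin.last k]) (Fin.last 1) = z (Fin.last k) := by
    simp
  have h2 : Fin.init (z ∘ ![Fin.castSucc i, Fin.last k]) 0 = z (Fin.castSucc i) := by
    simp [Fin.init]
  rw [h1, h2]
  rfl

include hw in
/-- `w` is Borel measurable. -/
theorem measurable_weight : Measurable w := by
  have h := IsSemialgebraicFunOn.measurable_holds hw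
  have h2 : Measurable (fun t : Fin 1 → ℝ => w (t 0)) :=
    h.comp (Measurable.subtype_mk (p := fun x => x ∈ (univ : Set (Fin 1 → ℝ)))
      (h := fun _ => mem_univ _) measurable_id)
  exact h2.comp (measurable_pi_lambda (fun x : ℝ => fun _ : Fin 1 => x) fun _ => measurable_id)

/-- The reweighted representation `[σ, w(x₀)·f]` (dimension `k ≥ 1`). -/
def reweight (hw : IsSemialgebraicFunOn ℚ (univ : Set (Fin 1 → ℝ)) (fun t => w (t 0)))
    (hM : ∀ x : ℝ, |w x| ≤ M) {k : ℕ} (hk : 0 < k) (r : KZ.IntegralRep k) : KZ.IntegralRep k where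
  domain := r.domain
  integrand := fun x => w (x ⟨0, hk⟩) * r.integrand x
  isSemialgebraic_domain := r.isSemialgebraic_domain
  isSemialgebraicFunOn_integrand :=
    IsSemialgebraicFunOn.mul_holds
      ((isSemialgebraicFunOn_coord hw ⟨0, hk⟩).mono (subset_univ _) r.isSemialgebraic_domain)
      r.isSemialgebraicFunOn_integrand
  integrableOn := by
    have hmeas : AEStronglyMeasurable (fun x : Fin k → ℝ => w (x ⟨0, hk⟩))
        (volume.restrict r.domain) :=
      ((measurable_weight hw).comp (measurable_pi_apply _)).aestronglyMeasurable
    refine r.integrableOn.bdd_mul hmeas (c := M) (Eventually.of_forall fun x => ?_)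
    rw [Real.norm_eq_abs]
    exact hM _

@[simp] theorem reweight_domain {k : ℕ} (hk : 0 < k) (r : KZ.IntegralRep k) :
    (reweight hw hM hk r).domain = r.domain := rfl

@[simp] theorem reweight_integrand {k : ℕ} (hk : 0 < k) (r : KZ.IntegralRep k) :
    (reweight hw hM hk r).integrand = fun x => w (x ⟨0, hk⟩) * r.integrand x := rfl

/-- Reweighting on generators of `FormalRep` (constants are fixed). -/
def reweightGen (hw : IsSemialgebraicFunOn ℚ (univ : Set (Fin 1 → ℝ)) (fun t => w (t 0)))
    (hM : ∀ x : ℝ, |w x| ≤ M) : (Σ k, KZ.IntegralRep k) → KZ.FormalRep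
  | ⟨0, r⟩ => KZ.of r
  | ⟨k + 1, r⟩ => KZ.of (reweight hw hM (Nat.succ_pos k) r)

/-- **The reweighting endomorphism** `φ : FormalRep →+ FormalRep`. -/
def reweightMap (hw : IsSemialgebraicFunOn ℚ (univ : Set (Fin 1 → ℝ)) (fun t => w (t 0)))
    (hM : ∀ x : ℝ, |w x| ≤ M) : KZ.FormalRep →+ KZ.FormalRep :=
  FreeAbelianGroup.lift (reweightGen hw hM)

@[simp] theorem reweightMap_of {n : ℕ} (r : KZ.IntegralRep (n + 1)) :
    reweightMap hw hM (KZ.of r) = KZ.of (reweight hw hM (Nat.succ_pos n) r) :=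
  FreeAbelianGroup.lift_apply_of _ _

@[simp] theorem reweightMap_of_zero (r : KZ.IntegralRep 0) :
    reweightMap hw hM (KZ.of r) = KZ.of r :=
  FreeAbelianGroup.lift_apply_of _ _

theorem reweightMap_of_pos {k : ℕ} (hk : 0 < k) (r : KZ.IntegralRep k) :
    reweightMap hw hM (KZ.of r) = KZ.of (reweight hw hM hk r) := by
  obtain ⟨n, rfl⟩ : ∃ n, k = n + 1 := ⟨k - 1, by omega⟩
  exact reweightMap_of hw hM r

/-! ### The four kinds of fibred generators are preserved -/

variable {n : ℕ}

theorem reweight_mem_domainAddRel {r r₁ r₂ : KZ.IntegralRep (n + 1)}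
    (hdom : r.domain = r₁.domain ∪ r₂.domain) (hnull : volume (r₁.domain ∩ r₂.domain) = 0)
    (h₁ : EqOn r.integrand r₁.integrand r₁.domain) (h₂ : EqOn r.integrand r₂.integrand r₂.domain) :
    KZ.of (reweight hw hM (Nat.succ_pos n) r) - KZ.of (reweight hw hM (Nat.succ_pos n) r₁) -
      KZ.of (reweight hw hM (Nat.succ_pos n) r₂) ∈ KZ.domainAddRel :=
  ⟨n + 1, reweight hw hM (Nat.succ_pos n) r, reweight hw hM (Nat.succ_pos n) r₁,
    reweight hw hM (Nat.succ_pos n) r₂, hdom, hnull, fun z hz => by simp [h₁ hz],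
    fun z hz => by simp [h₂ hz], rfl⟩

theorem reweight_mem_integrandAddRel {r r₁ r₂ : KZ.IntegralRep (n + 1)}
    (h₁ : r₁.domain = r.domain) (h₂ : r₂.domain = r.domain)
    (hadd : EqOn r.integrand (r₁.integrand + r₂.integrand) r.domain) :
    KZ.of (reweight hw hM (Nat.succ_pos n) r) - KZ.of (reweight hw hM (Nat.succ_pos n) r₁) -
      KZ.of (reweight hw hM (Nat.succ_pos n) r₂) ∈ KZ.integrandAddRel :=
  ⟨n + 1, reweight hw hM (Nat.succ_pos n) r, reweight hw hM (Nat.succ_pos n) r₁,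
    reweight hw hM (Nat.succ_pos n) r₂, h₁, h₂, fun z hz => by simp [hadd hz, mul_add], rfl⟩

theorem reweight_mem_fibredChangeOfVariablesRel {r r' : KZ.IntegralRep (n + 1)}
    {Φ : (Fin (n + 1) → ℝ) → (Fin (n + 1) → ℝ)}
    {Φ' : (Fin (n + 1) → ℝ) → (Fin (n + 1) → ℝ) →L[ℝ] (Fin (n + 1) → ℝ)}
    (hΦ : IsSemialgebraicMapOn ℚ r.domain Φ)
    (hΦ' : ∀ x ∈ r.domain, HasFDerivWithinAt Φ (Φ' x) r.domain x) (hinj : InjOn Φ r.domain)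
    (hdom : r'.domain = Φ '' r.domain)
    (hf : ∀ x ∈ r.domain, r.integrand x = r'.integrand (Φ x) * |(Φ' x).det|)
    (h0 : ∀ x ∈ r.domain, Φ x 0 = x 0) :
    KZ.of (reweight hw hM (Nat.succ_pos n) r) - KZ.of (reweight hw hM (Nat.succ_pos n) r') ∈
      KZ.fibredChangeOfVariablesRel := by
  refine ⟨n, reweight hw hM (Nat.succ_pos n) r, reweight hw hM (Nat.succ_pos n) r', Φ, Φ', hΦ,
    hΦ', hinj, hdom, fun x hx => ?_, h0, rfl⟩
  have e : (⟨0, Nat.succ_pos n⟩ : Fin (n + 1)) = 0 := rfl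
  simp only [reweight_integrand, e]
  rw [h0 x hx, hf x hx, mul_assoc]

theorem snoc_zero' (x : Fin (n + 1) → ℝ) (t : ℝ) :
    (Fin.snoc x t : Fin (n + 2) → ℝ) ⟨0, Nat.succ_pos (n + 1)⟩ = x 0 := by
  have : (⟨0, Nat.succ_pos (n + 1)⟩ : Fin (n + 2)) = Fin.castSucc (0 : Fin (n + 1)) := rfl
  rw [this, Fin.snoc_castSucc]

theorem reweight_mem_newtonLeibnizRel {r : KZ.IntegralRep (n + 2)} {r' : KZ.IntegralRep (n + 1)}
    {α β : (Fin (n + 1) → ℝ) → ℝ} {F : (Fin (n + 2) → ℝ) → ℝ}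
    (hF : IsSemialgebraicFunOn ℚ r.domain F)
    (hα : IsSemialgebraicFunOn ℚ r'.domain α) (hβ : IsSemialgebraicFunOn ℚ r'.domain β)
    (hle : ∀ x ∈ r'.domain, α x ≤ β x)
    (hband : r.domain = {z | (Fin.init z : Fin (n + 1) → ℝ) ∈ r'.domain ∧
      α (Fin.init z) ≤ z (Fin.last (n + 1)) ∧ z (Fin.last (n + 1)) ≤ β (Fin.init z)})
    (hcont : ∀ x ∈ r'.domain, ContinuousOn (fun t : ℝ => F (Fin.snoc x t)) (Icc (α x) (β x)))
    (hderiv : ∀ x ∈ r'.domain, ∀ t ∈ Ioo (α x) (β x),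
      HasDerivAt (fun s : ℝ => F (Fin.snoc x s)) (r.integrand (Fin.snoc x t)) t)
    (hr' : ∀ x ∈ r'.domain, r'.integrand x = F (Fin.snoc x (β x)) - F (Fin.snoc x (α x))) :
    KZ.of (reweight hw hM (Nat.succ_pos (n + 1)) r) - KZ.of (reweight hw hM (Nat.succ_pos n) r') ∈
      KZ.newtonLeibnizRel := by
  refine ⟨n + 1, reweight hw hM (Nat.succ_pos (n + 1)) r, reweight hw hM (Nat.succ_pos n) r', α, β,
    fun z => w (z ⟨0, Nat.succ_pos (n + 1)⟩) * F z, ?_, hα, hβ, hle,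
    hband, fun x hx => ?_, fun x hx t ht => ?_, fun x hx => ?_, rfl⟩
  · exact IsSemialgebraicFunOn.mul_holds
      ((isSemialgebraicFunOn_coord hw ⟨0, Nat.succ_pos (n + 1)⟩).mono (subset_univ _)
        r.isSemialgebraic_domain) hF
  · simp only [snoc_zero']
    exact (hcont x hx).const_smul (w (x 0)) |>.congr fun t _ => by simp [smul_eq_mul]
  · simp only [snoc_zero', reweight_integrand]
    exact (hderiv x hx t ht).const_mul (w (x 0))
  · have e : (⟨0, Nat.succ_pos n⟩ : Fin (n + 1)) = 0 := rfl
    simp only [reweight_integrand, snoc_zero', e]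
    rw [hr' x hx, mul_sub]

/-- **`φ` preserves the fibred relations.** -/
theorem reweightMap_mem_fibredRelations {c : KZ.FormalRep} (hc : c ∈ KZ.fibredRelations) :
    reweightMap hw hM c ∈ KZ.fibredRelations := by
  refine (AddSubgroup.closure_le (KZ.fibredRelations.comap (reweightMap hw hM))).mpr ?_ hc
  rintro c (((hc | hc) | hc) | hc)
  · obtain ⟨k, r, r₁, r₂, hdom, hnull, h₁, h₂, rfl⟩ := hc
    rw [AddSubgroup.coe_comap, mem_preimage, map_sub, map_sub]
    cases k with
    | zero =>
      rw [reweightMap_of_zero, reweightMap_of_zero, reweightMap_of_zero]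
      exact KZ.mem_fibredRelations_of_mem_domainAddRel ⟨0, r, r₁, r₂, hdom, hnull, h₁, h₂, rfl⟩
    | succ k =>
      rw [reweightMap_of, reweightMap_of, reweightMap_of]
      exact KZ.mem_fibredRelations_of_mem_domainAddRel
        (reweight_mem_domainAddRel hw hM hdom hnull h₁ h₂)
  · obtain ⟨k, r, r₁, r₂, h₁, h₂, hadd, rfl⟩ := hc
    rw [AddSubgroup.coe_comap, mem_preimage, map_sub, map_sub]
    cases k with
    | zero =>
      rw [reweightMap_of_zero, reweightMap_of_zero, reweightMap_of_zero]
      exact KZ.mem_fibredRelations_of_mem_integrandAddRel ⟨0, r, r₁, r₂, h₁, h₂, hadd, rfl⟩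
    | succ k =>
      rw [reweightMap_of, reweightMap_of, reweightMap_of]
      exact KZ.mem_fibredRelations_of_mem_integrandAddRel
        (reweight_mem_integrandAddRel hw hM h₁ h₂ hadd)
  · obtain ⟨k, r, r', Φ, Φ', hΦ, hΦ', hinj, hdom, hf, h0, rfl⟩ := hc
    rw [AddSubgroup.coe_comap, mem_preimage, map_sub, reweightMap_of, reweightMap_of]
    exact KZ.mem_fibredRelations_of_mem_fibredChangeOfVariablesRel
      (reweight_mem_fibredChangeOfVariablesRel hw hM hΦ hΦ' hinj hdom hf h0)
  · obtain ⟨k, r, r', α, β, F, hF, hα, hβ, hle, hband, hcont, hderiv, hr', rfl⟩ :=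
      KZ.mem_fibredNewtonLeibnizRel_iff.mp hc
    rw [AddSubgroup.coe_comap, mem_preimage, map_sub, reweightMap_of, reweightMap_of]
    exact KZ.mem_fibredRelations_of_mem_fibredNewtonLeibnizRel (KZ.of_sub_of_mem_fibredNewtonLeibnizRel
      (reweight_mem_newtonLeibnizRel hw hM hF hα hβ hle hband hcont hderiv hr'))

end Weight

/-- **`stub_reweighting` holds** (verbatim the registered signature of skeleton d39c9ad6). -/
theorem stub_reweighting_holds :
    ∀ (w : ℝ → ℝ) (M : ℝ), Literature.NumberTheory.Transcendental.IsSemialgebraicFunOn ℚ (Set.univ : Set (Fin 1 → ℝ)) (fun t => w (t 0)) → (∀ x : ℝ, |w x| ≤ M) → ∃ φ : Literature.NumberTheory.Transcendental.KZ.FormalRep →+ Literature.NumberTheory.Transcendental.KZ.FormalRep, (∀ (k : ℕ) (hk : 0 < k) (r : Literature.NumberTheory.Transcendental.KZ.IntegralRep k), ∃ r' : Literature.NumberTheory.Transcendental.KZ.IntegralRep k, r'.domain = r.domain ∧ (r'.integrand = fun x => w (x ⟨0, hk⟩) * r.integrand x) ∧ φ (Literature.NumberTheory.Transcendental.KZ.of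 r) = Literature.NumberTheory.Transcendental.KZ.of r') ∧ ∀ c ∈ Literature.NumberTheory.Transcendental.KZ.fibredRelations, φ c ∈ Literature.NumberTheory.Transcendental.KZ.fibredRelations := by
  intro w M hw hM
  refine ⟨reweightMap hw hM, fun k hk r => ⟨reweight hw hM hk r, rfl, rfl, reweightMap_of_pos hw hM hk r⟩,
    fun c hc => reweightMap_mem_fibredRelations hw hM hc⟩


/-! ## stub_engineAssembly -/


open MeasureTheory Set Filter MvPolynomial
open Literature.NumberTheory.Transcendental Literature.ModelTheory.ExponentialFields

/-! ### Small representations -/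

/-- The closed rational coordinate interval `{a ≤ t 0 ≤ b} ⊆ ℝ¹` is `ℚ`-semialgebraic. -/
theorem isSemialgebraic_iccSet' (a b : ℚ) :
    IsSemialgebraic ℚ {t : Fin 1 → ℝ | (a : ℝ) ≤ t 0 ∧ t 0 ≤ (b : ℝ)} := by
  have h1 := isSemialgebraic_setOf_eval_le (k := ℚ) (R := ℝ) (C a) (X (0 : Fin 1))
  have h2 := isSemialgebraic_setOf_eval_le (k := ℚ) (R := ℝ) (X (0 : Fin 1)) (C b)
  simp only [aeval_X, aeval_C, eq_ratCast] at h1 h2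
  simpa [setOf_and] using h1.inter h2

theorem iccSet_eq_pi' (a b : ℚ) :
    {t : Fin 1 → ℝ | (a : ℝ) ≤ t 0 ∧ t 0 ≤ (b : ℝ)} = Set.pi univ (fun _ => Icc (a : ℝ) b) := by
  ext t
  simp [Pi.le_def, Fin.forall_fin_one]

/-- **The interval representation `[[a,b], (b−a)⁻¹]` exists** (as in Negative/SpectatorEngine.lean,
re-proved here to keep this file import-light). -/
theorem exists_intervalRep' (a b : ℚ) :
    ∃ u : KZ.IntegralRep 1, u.domain = {t : Fin 1 → ℝ | (a : ℝ) ≤ t 0 ∧ t 0 ≤ (b : ℝ)} ∧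
      u.integrand = fun _ => ((b - a : ℚ) : ℝ)⁻¹ :=
  ⟨{ domain := {t : Fin 1 → ℝ | (a : ℝ) ≤ t 0 ∧ t 0 ≤ (b : ℝ)}
     integrand := fun _ => ((b - a : ℚ) : ℝ)⁻¹
     isSemialgebraic_domain := isSemialgebraic_iccSet' a b
     isSemialgebraicFunOn_integrand := by
       refine (isSemialgebraicFunOn_aeval (isSemialgebraic_iccSet' a b) (C ((b - a)⁻¹))).congr
         fun z _ => ?_
       simp only [aeval_C, eq_ratCast]
       push_cast
       rfl
     integrableOn := by
       refine integrableOn_const ?_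
       rw [iccSet_eq_pi', volume_pi_pi]
       simp [Real.volume_Icc] }, rfl, rfl⟩

/-- The representation `[D, 0]`. -/
def zeroOn {m : ℕ} (D : Set (Fin m → ℝ)) (hD : IsSemialgebraic ℚ D) : KZ.IntegralRep m where
  domain := D
  integrand := fun _ => 0
  isSemialgebraic_domain := hD
  isSemialgebraicFunOn_integrand := by simpa using isSemialgebraicFunOn_aeval hD 0
  integrableOn := integrableOn_zero

theorem of_zeroOn_mem_relations {m : ℕ} (D : Set (Fin m → ℝ)) (hD : IsSemialgebraic ℚ D) :
    KZ.of (zeroOn D hD) ∈ KZ.relations := by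
  have h : KZ.of (zeroOn D hD) - KZ.of (zeroOn D hD) - KZ.of (zeroOn D hD) ∈ KZ.relations :=
    KZ.integrandAddRel_subset_relations ⟨m, _, _, _, rfl, rfl, fun z _ => by simp [zeroOn], rfl⟩
  have h2 := KZ.relations.neg_mem h
  have h3 : -(KZ.of (zeroOn D hD) - KZ.of (zeroOn D hD) - KZ.of (zeroOn D hD)) = KZ.of (zeroOn D hD) := by
    abel
  rwa [h3] at h2

/-- A representation whose integrand vanishes ON its domain is a relation (one integrand-additivity
instance `[r] − [r] − [r]`). -/
theorem of_mem_relations_of_eqOn_zero {m : ℕ} (r : KZ.IntegralRep m) (h : EqOn r.integrand 0 r.domain) :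
    KZ.of r ∈ KZ.relations := by
  have h1 : KZ.of r - KZ.of r - KZ.of r ∈ KZ.relations :=
    KZ.integrandAddRel_subset_relations ⟨m, r, r, r, rfl, rfl, fun z hz => by simp [h hz], rfl⟩
  have h2 := KZ.relations.neg_mem h1
  have h3 : -(KZ.of r - KZ.of r - KZ.of r) = KZ.of r := by abel
  rwa [h3] at h2

/-- The slab `{a ≤ z₀ ≤ b} ⊆ ℝ¹⁺ᵏ` is `ℚ`-semialgebraic. -/
theorem isSemialgebraic_slabSet {k : ℕ} (hk : 0 < 1 + k) (a b : ℚ) :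
    IsSemialgebraic ℚ {z : Fin (1 + k) → ℝ | (a : ℝ) ≤ z ⟨0, hk⟩ ∧ z ⟨0, hk⟩ ≤ (b : ℝ)} := by
  have h1 := isSemialgebraic_setOf_eval_le (k := ℚ) (R := ℝ) (C a) (X (⟨0, hk⟩ : Fin (1 + k)))
  have h2 := isSemialgebraic_setOf_eval_le (k := ℚ) (R := ℝ) (X (⟨0, hk⟩ : Fin (1 + k))) (C b)
  simp only [aeval_X, aeval_C, eq_ratCast] at h1 h2
  simpa [setOf_and] using h1.inter h2

/-! ### The generatorwise computation -/

section Key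

variable {s : KZ.IntegralRep 1} {a b : ℚ} {w : ℝ → ℝ}
  (hgood : ∀ t : Fin 1 → ℝ, (a : ℝ) ≤ t 0 → t 0 ≤ (b : ℝ) →
    t ∈ s.domain ∧ w (t 0) * s.integrand t = ((b - a : ℚ) : ℝ)⁻¹)
  (hzero : ∀ x : ℝ, (x < (a : ℝ) ∨ (b : ℝ) < x) → w x = 0)
  {u : KZ.IntegralRep 1} (hudom : u.domain = {t : Fin 1 → ℝ | (a : ℝ) ≤ t 0 ∧ t 0 ≤ (b : ℝ)})
  (huint : u.integrand = fun _ => ((b - a : ℚ) : ℝ)⁻¹)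

include hgood hzero hudom huint in
/-- **Key step**: the reweighted product `[σ × τ, w(z₀)·(s ⊗ r)]` is equivalent to `[u]·[r]`. -/
theorem of_reweightedProd_sub_mem_relations {k : ℕ} (r : KZ.IntegralRep k) (hk : 0 < 1 + k)
    (r' : KZ.IntegralRep (1 + k)) (hdom' : r'.domain = (s.prod r).domain)
    (hint' : r'.integrand = fun x => w (x ⟨0, hk⟩) * (s.prod r).integrand x) :
    KZ.of r' - KZ.of (u.prod r) ∈ KZ.relations := by
  -- coordinates
  have i0 : Fin.castAdd k (0 : Fin 1) = (⟨0, hk⟩ : Fin (1 + k)) := Fin.ext (by simp)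
  -- the slab and the two pieces of `r'`
  set I := {z : Fin (1 + k) → ℝ | (a : ℝ) ≤ z ⟨0, hk⟩ ∧ z ⟨0, hk⟩ ≤ (b : ℝ)} with hI
  have hIsa : IsSemialgebraic ℚ I := isSemialgebraic_slabSet hk a b
  set rA := r'.restrict (r'.domain ∩ I) (r'.isSemialgebraic_domain.inter hIsa) inter_subset_left
    with hrA
  set rB := r'.restrict (r'.domain \ I) (r'.isSemialgebraic_domain.diff hIsa) sdiff_subset with hrB
  -- (1) domain additivity
  have h1 : KZ.of r' - KZ.of rA - KZ.of rB ∈ KZ.relations :=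
    KZ.domainAddRel_subset_relations ⟨1 + k, r', rA, rB, by simp [hrA, hrB],
      measure_mono_null (fun z hz => (hz.2.2 hz.1.2).elim) measure_empty,
      fun _ _ => rfl, fun _ _ => rfl, rfl⟩
  -- (2) off the slab the integrand vanishes on the domain
  have h2 : KZ.of rB ∈ KZ.relations := by
    refine of_mem_relations_of_eqOn_zero rB fun z hz => ?_
    have hzI : z ∉ I := hz.2
    have hout : z ⟨0, hk⟩ < (a : ℝ) ∨ (b : ℝ) < z ⟨0, hk⟩ := by
      simp only [hI, mem_setOf_eq, not_and_or, not_le] at hzI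
      exact hzI
    have hw0 : w (z ⟨0, hk⟩) = 0 := hzero _ hout
    show r'.integrand z = 0
    rw [hint']
    show w (z ⟨0, hk⟩) * (s.prod r).integrand z = 0
    rw [hw0, zero_mul]
  -- (3) on the slab: `rA` agrees with `[u]·[r]` on the common domain
  have hdomA : (u.prod r).domain = rA.domain := by
    ext z
    simp only [hrA, KZ.IntegralRep.domain_restrict, hdom', KZ.IntegralRep.prod_domain,
      KZ.IntegralRep.mem_prodDomain, hudom, mem_inter_iff, mem_setOf_eq, hI, i0]
    constructor
    · rintro ⟨⟨h1, h2⟩, hr⟩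
      refine ⟨⟨(hgood (fun i => z (Fin.castAdd k i)) ?_ ?_).1, hr⟩, h1, h2⟩
      · show (a : ℝ) ≤ z (Fin.castAdd k 0)
        rw [i0]; exact h1
      · show z (Fin.castAdd k 0) ≤ (b : ℝ)
        rw [i0]; exact h2
    · rintro ⟨⟨-, hr⟩, h1, h2⟩
      exact ⟨⟨h1, h2⟩, hr⟩
  have hAsa : IsSemialgebraic ℚ rA.domain := rA.isSemialgebraic_domain
  have h3 : KZ.of rA - KZ.of (u.prod r) - KZ.of (zeroOn rA.domain hAsa) ∈ KZ.relations := by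
    refine KZ.integrandAddRel_subset_relations ⟨1 + k, rA, u.prod r, zeroOn rA.domain hAsa, hdomA,
      rfl, fun z hz => ?_, rfl⟩
    have hz' : (a : ℝ) ≤ z ⟨0, hk⟩ ∧ z ⟨0, hk⟩ ≤ (b : ℝ) := hz.2
    have hg := (hgood (fun i => z (Fin.castAdd k i))
      (by show (a : ℝ) ≤ z (Fin.castAdd k 0); rw [i0]; exact hz'.1)
      (by show z (Fin.castAdd k 0) ≤ (b : ℝ); rw [i0]; exact hz'.2)).2
    have hg' : w (z ⟨0, hk⟩) * s.integrand (fun i => z (Fin.castAdd k i)) = ((b - a : ℚ) : ℝ)⁻¹ := by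
      have := hg
      simp only [i0] at this
      exact this
    simp only [hrA, KZ.IntegralRep.integrand_restrict, hint', KZ.IntegralRep.prod_integrand_eq,
      KZ.IntegralRep.prodFun_apply, huint, Pi.add_apply, zeroOn, add_zero]
    rw [← mul_assoc, hg']
  have h4 := of_zeroOn_mem_relations rA.domain hAsa
  -- assemble
  have h5 : KZ.of rA - KZ.of (u.prod r) ∈ KZ.relations := by
    have := KZ.relations.add_mem h3 h4
    rwa [sub_add_cancel] at this
  have : KZ.of r' - KZ.of (u.prod r) = (KZ.of r' - KZ.of rA - KZ.of rB) + KZ.of rB +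
      (KZ.of rA - KZ.of (u.prod r)) := by abel
  rw [this]
  exact KZ.relations.add_mem (KZ.relations.add_mem h1 h2) h5

end Key

/-! ### The engine -/

/-- `FibredSpectatorCancellation₁`, the engine's conclusion. -/
def FSC₁ : Prop :=
  ∀ (s : KZ.IntegralRep 1) (c : KZ.FormalRep), s.value ≠ 0 →
    KZ.of s * c ∈ KZ.fibredRelations → c ∈ KZ.relations

/-- **`stub_engineAssembly` holds** (verbatim the registered signature of skeleton d39c9ad6). -/
theorem stub_engineAssembly_holds :
    (∀ (w : ℝ → ℝ) (M : ℝ), Literature.NumberTheory.Transcendental.IsSemialgebraicFunOn ℚ (Set.univ : Set (Fin 1 → ℝ)) (fun t => w (t 0)) → (∀ x : ℝ, |w x| ≤ M) → ∃ φ : Literature.NumberTheory.Transcendental.KZ.FormalRep →+ Literature.NumberTheory.Transcendental.KZ.FormalRep, (∀ (k : ℕ) (hk : 0 < k) (r : Literature.NumberTheory.Transcendental.KZ.IntegralRep k), ∃ r' : Literature.NumberTheory.Transcendental.KZ.IntegralRep k, r'.domain = r.domain ∧ (r'.integrand = fun x => w (x ⟨0, hk⟩) * r.integrand x) ∧ φ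 (Literature.NumberTheory.Transcendental.KZ.of r) = Literature.NumberTheory.Transcendental.KZ.of r') ∧ ∀ c ∈ Literature.NumberTheory.Transcendental.KZ.fibredRelations, φ c ∈ Literature.NumberTheory.Transcendental.KZ.fibredRelations) → (∀ (s : Literature.NumberTheory.Transcendental.KZ.IntegralRep 1), s.value ≠ 0 → ∃ (a b : ℚ) (w : ℝ → ℝ) (M : ℝ), a < b ∧ Literature.NumberTheory.Transcendental.IsSemialgebraicFunOn ℚ (Set.univ : Set (Fin 1 → ℝ)) (fun t => w (t 0)) ∧ (∀ x : ℝ, |w x| ≤ M) ∧ (∀ t : Fin 1 → ℝ, (a : ℝ) ≤ t 0 → t 0 ≤ (b : ℝ) → t ∈ s.domain ∧ w (t 0) * s.integrand t = ((b - a : ℚ) : ℝ)⁻¹) ∧ (∀ x : ℝ, (x < (a : ℝ) ∨ (b : ℝ) < x) → w x = 0)) → (∀ (a b : ℚ) (u : Literature.NumberTheory.Transcendental.KZ.IntegralRep 1), a < b → u.domain = {t : Fin 1 → ℝ | (a : ℝ) ≤ t 0 ∧ t 0 ≤ (b : ℝ)} → (u.integrand = fun _ => ((b - a : ℚ) : ℝ)⁻¹)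 → ∀ c : Literature.NumberTheory.Transcendental.KZ.FormalRep, Literature.NumberTheory.Transcendental.KZ.of u * c - c ∈ Literature.NumberTheory.Transcendental.KZ.relations) → ∀ (s : Literature.NumberTheory.Transcendental.KZ.IntegralRep 1) (c : Literature.NumberTheory.Transcendental.KZ.FormalRep), s.value ≠ 0 → Literature.NumberTheory.Transcendental.KZ.of s * c ∈ Literature.NumberTheory.Transcendental.KZ.fibredRelations → c ∈ Literature.NumberTheory.Transcendental.KZ.relations := by
  intro hR hG hI s c hs hsc
  obtain ⟨a, b, w, M, hab, hw, hM, hgood, hzero⟩ := hG s hs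
  obtain ⟨φ, hφ, hφfib⟩ := hR w M hw hM
  obtain ⟨u, hudom, huint⟩ := exists_intervalRep' a b
  -- `φ([s]·c) ∈ relations`
  have h1 : φ (KZ.of s * c) ∈ KZ.relations := KZ.fibredRelations_le_relations (hφfib _ hsc)
  -- `φ([s]·c) − [u]·c ∈ relations`, generatorwise
  have h2 : ∀ d : KZ.FormalRep, φ (KZ.of s * d) - KZ.of u * d ∈ KZ.relations := by
    intro d
    induction d using FreeAbelianGroup.induction_on with
    | zero => simp [KZ.relations.zero_mem]
    | of x =>
      obtain ⟨k, r⟩ := x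
      change φ (KZ.of s * KZ.of r) - KZ.of u * KZ.of r ∈ KZ.relations
      rw [KZ.of_mul_of, KZ.of_mul_of]
      have hk : 0 < 1 + k := by omega
      obtain ⟨r', hdom', hint', hφr⟩ := hφ (1 + k) hk (s.prod r)
      rw [hφr]
      exact of_reweightedProd_sub_mem_relations hgood hzero hudom huint r hk r' hdom' hint'
    | neg x ih =>
      have := KZ.relations.neg_mem ih
      convert this using 1
      rw [mul_neg, mul_neg, map_neg]
      abel
    | add x y hx hy =>
      have := KZ.relations.add_mem hx hy
      convert this using 1
      rw [mul_add, mul_add, map_add]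
      abel
  -- `[u]·c − c ∈ relations`
  have h3 : KZ.of u * c - c ∈ KZ.relations := hI a b u hab hudom huint c
  have h4 : KZ.of u * c ∈ KZ.relations := by
    have := KZ.relations.sub_mem h1 (h2 c)
    rwa [sub_sub_cancel] at this
  have h5 := KZ.relations.sub_mem h4 h3
  rwa [sub_sub_cancel] at h5


/-! ## `stub_intervalUnit` (gen-1 drefute seat `refuter-drefute-stmt-KontsevichZagierPeriods-2837-0`,
crux workfile `DrefuteStubIntervalUnit.lean`, reproduced verbatim so that this file is self-contained) -/

section IntervalUnit

open Literature.NumberTheory.Transcendental MeasureTheory Set MvPolynomial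

/-- `[[a,b], (b-a)⁻¹] − [pt, 1] ∈ relations`: a single Newton–Leibniz move over the point, primitive
`F(t) = (t − a)(b − a)⁻¹`. [folklore] -/
theorem of_interval_sub_of_unit_mem_relations (a b : ℚ) (u : KZ.IntegralRep 1) (hab : a < b)
    (hdom : u.domain = {t : Fin 1 → ℝ | (a : ℝ) ≤ t 0 ∧ t 0 ≤ (b : ℝ)})
    (hint : u.integrand = fun _ => ((b - a : ℚ) : ℝ)⁻¹) :
    KZ.of u - KZ.of KZ.IntegralRep.unit ∈ KZ.relations := by
  apply KZ.newtonLeibnizRel_subset_relations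
  have hba : ((b - a : ℚ) : ℝ) ≠ 0 := by
    have : (a : ℝ) < b := by exact_mod_cast hab
    push_cast; linarith
  set F : (Fin (0 + 1) → ℝ) → ℝ := fun z => (z (Fin.last 0) - (a : ℝ)) * ((b - a : ℚ) : ℝ)⁻¹ with hF
  refine ⟨0, u, KZ.IntegralRep.unit, fun _ => (a : ℝ), fun _ => (b : ℝ), F, ?_, ?_, ?_, ?_, ?_, ?_, ?_, ?_, rfl⟩
  · refine (isSemialgebraicFunOn_aeval u.isSemialgebraic_domain
      ((X (Fin.last 0) - C a) * C ((b - a)⁻¹))).congr fun z _ => ?_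
    simp only [hF, map_mul, map_sub, aeval_X, aeval_C, eq_ratCast]
    push_cast
    ring
  · refine (isSemialgebraicFunOn_aeval KZ.IntegralRep.unit.isSemialgebraic_domain (C a)).congr
      fun z _ => ?_
    simp
  · refine (isSemialgebraicFunOn_aeval KZ.IntegralRep.unit.isSemialgebraic_domain (C b)).congr
      fun z _ => ?_
    simp
  · intro x _
    show (a : ℝ) ≤ (b : ℝ)
    exact_mod_cast hab.le
  · ext z
    simp only [hdom, mem_setOf_eq, KZ.IntegralRep.unit_domain, mem_univ, true_and]
    rfl
  · intro x _
    simp only [hF, Fin.snoc_last]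
    fun_prop
  · intro x _ t _
    simp only [hF, Fin.snoc_last, hint]
    simpa using ((hasDerivAt_id t).sub_const (a : ℝ)).mul_const (((b - a : ℚ) : ℝ)⁻¹)
  · intro x _
    simp only [hF, Fin.snoc_last, KZ.IntegralRep.unit_integrand]
    rw [sub_self, zero_mul, sub_zero]
    push_cast at hba ⊢
    field_simp

/-- **`stub_intervalUnit` holds** (verbatim the registered signature; gen-1 proof). [folklore] -/
theorem stub_intervalUnit_holds :
    ∀ (a b : ℚ) (u : Literature.NumberTheory.Transcendental.KZ.IntegralRep 1), a < b → u.domain = {t : Fin 1 → ℝ | (a : ℝ) ≤ t 0 ∧ t 0 ≤ (b : ℝ)} → (u.integrand = fun _ => ((b - a : ℚ) : ℝ)⁻¹) → ∀ c : Literature.NumberTheory.Transcendental.KZ.FormalRep, Literature.NumberTheory.Transcendental.KZ.of u * c - c ∈ Literature.NumberTheory.Transcendental.KZ.relations := by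
  intro a b u hab hdom hint c
  have h1 : (KZ.of u - KZ.of KZ.IntegralRep.unit) * c ∈ KZ.relations :=
    KZ.mul_mem_relations_right_holds _ _ (of_interval_sub_of_unit_mem_relations a b u hab hdom hint)
  have h2 := KZ.of_unit_mul_sub_mem_relations c
  have : KZ.of u * c - c =
      (KZ.of u - KZ.of KZ.IntegralRep.unit) * c + (KZ.of KZ.IntegralRep.unit * c - c) := by
    rw [sub_mul]; abel
  rw [this]
  exact KZ.relations.add_mem h1 h2

end IntervalUnit

/-! ## The engine, unconditionally; the exact split of the kernel conjecture -/

/-- **`FibredSpectatorCancellation₁` is a THEOREM**: for a one-dimensional spectator `s` of non-zero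
value, `[s]·c ∈ KZ.fibredRelations → c ∈ KZ.relations`. (All four engine stubs of skeleton d39c9ad6
are proved above; this is `stub_engineAssembly` fed with the other three.) -/
theorem fibredSpectatorCancellation₁ : FSC₁ :=
  stub_engineAssembly_holds stub_reweighting_holds stub_goodWeight_holds stub_intervalUnit_holds

/-- The conjunct `stub_darkTorsion` of the skeleton, verbatim. -/
def DarkTorsion₁ : Prop :=
  ∀ c : KZ.FormalRep, KZ.eval c = 0 → ∃ s : KZ.IntegralRep 1, s.value ≠ 0 ∧ KZ.of s * c ∈ KZ.relations

/-- The conjunct `stub_spectatorFibration` of the skeleton, verbatim. -/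
def SpectatorFibration₁ : Prop :=
  ∀ (s : KZ.IntegralRep 1) (c : KZ.FormalRep), s.value ≠ 0 → KZ.of s * c ∈ KZ.relations →
    ∃ c' : KZ.FormalRep, c - c' ∈ KZ.relations ∧ KZ.of s * c' ∈ KZ.fibredRelations

/-- One-dimensional spectator cancellation `SC₁`. -/
def SpectatorCancellation₁ : Prop :=
  ∀ (s : KZ.IntegralRep 1) (c : KZ.FormalRep), s.value ≠ 0 → KZ.of s * c ∈ KZ.relations →
    c ∈ KZ.relations

/-- The kernel conjecture (the summit's kernel form; `KZKernelConjecture` of the route file unfolds to it). -/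
def Kernel : Prop := ∀ c : KZ.FormalRep, KZ.eval c = 0 → c ∈ KZ.relations

/-- **With the engine proved, `stub_spectatorFibration` IS `SC₁`** (unconditionally, no hypotheses left). -/
theorem spectatorFibration₁_iff_cancellation : SpectatorFibration₁ ↔ SpectatorCancellation₁ := by
  constructor
  · intro h s c hs hsc
    obtain ⟨c', hcc', hc'⟩ := h s c hs hsc
    have := KZ.relations.add_mem hcc' (fibredSpectatorCancellation₁ s c' hs hc')
    rwa [sub_add_cancel] at this
  · intro h s c hs hsc
    exact ⟨0, by simpa using h s c hs hsc, by simp [KZ.fibredRelations.zero_mem]⟩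

/-- **The exact split, now unconditional in the engine**: the kernel conjecture is EQUIVALENT to the
conjunction of the two open stubs of the skeleton. (`→`: spectator `[[0,1],1]`, `c' := 0`;
`←`: dark torsion gives `[s]·c ∈ relations`, fibration gives `c'`, the engine gives `c' ∈ relations`.) -/
theorem kernel_iff_darkTorsion₁_and_spectatorFibration₁ :
    Kernel ↔ DarkTorsion₁ ∧ SpectatorFibration₁ := by
  constructor
  · intro hK
    have hSC : SpectatorCancellation₁ := fun s c hs hsc => by
      -- `eval c = 0` since `[s]·c ∈ relations ≤ ker eval` and `eval ([s]·c) = value s · eval c`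
      have h0 : KZ.eval (KZ.of s * c) = 0 := KZ.relations_le_ker_eval_holds hsc
      rw [KZ.eval_mul', KZ.eval_of] at h0
      exact hK c ((mul_eq_zero.mp h0).resolve_left hs)
    refine ⟨fun c hc => ?_, spectatorFibration₁_iff_cancellation.mpr hSC⟩
    obtain ⟨u, hudom, huint⟩ := exists_intervalRep' 0 1
    refine ⟨u, ?_, KZ.mul_mem_relations_left_holds _ _ (hK c hc)⟩
    rw [KZ.IntegralRep.value, hudom, huint, iccSet_eq_pi', setIntegral_const]
    rw [Measure.real, volume_pi_pi]
    simp [Real.volume_Icc]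
  · rintro ⟨hD, hF⟩ c hc
    obtain ⟨s, hs, hsc⟩ := hD c hc
    obtain ⟨c', hcc', hc'⟩ := hF s c hs hsc
    have := KZ.relations.add_mem hcc' (fibredSpectatorCancellation₁ s c' hs hc')
    rwa [sub_add_cancel] at this

/-! ## By name: the tree's `KZKernelConjecture` and the crux `LogKernelConjecture` -/

/-- `Kernel` is the tree's `KZKernelConjecture` (definitional). -/
theorem kernel_iff_kzKernelConjecture : Kernel ↔ KZKernelConjecture := Iff.rfl

/-- **The exact split for the tree's kernel conjecture**: `KZKernelConjecture ↔ stub_darkTorsion ∧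
stub_spectatorFibration` (engine proved, no hypotheses). -/
theorem kzKernelConjecture_iff_darkTorsion₁_and_spectatorFibration₁ :
    KZKernelConjecture ↔ DarkTorsion₁ ∧ SpectatorFibration₁ :=
  kernel_iff_darkTorsion₁_and_spectatorFibration₁

/-- **The crux from the two open stubs alone** (the skeleton's glue with the engine discharged):
`stub_darkTorsion → stub_spectatorFibration → LogKernelConjecture`, via `KZKernelConjecture` and the
sandwich `of_kzKernelConjecture` (Theorems/LogKernelConjecture/Negative/Sandwich.lean). -/
theorem logKernelConjecture_of_darkTorsion₁_of_spectatorFibration₁ (hD : DarkTorsion₁)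
    (hF : SpectatorFibration₁) :
    Summit.KontsevichZagierPeriods.KontsevichZagierPeriods.Theses.LiouvilleUnfolding.LogKernelConjecture :=
  Summit.KontsevichZagierPeriods.LiouvilleUnfolding.LogKernelConjectureNegative.of_kzKernelConjecture
    (kzKernelConjecture_iff_darkTorsion₁_and_spectatorFibration₁.mpr ⟨hD, hF⟩)

end DrefuteSpectatorLocalisationG2
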